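import Mathlib
import Summits.Ventures.PercRepro2.SwOutAdjIneqCore
import Summits.Ventures.PercRepro2.SwOutJunctionsGTyped

/-!
# The adjacent-junction theorem on the general doubly typed side, I: the transports
(blind cell PercRepro2, night-4 g32, 2026-08-28; proofs/NIGHT4-G32.md §3)

g11's adjacent-junction theorem (SwOutAdjThm: ANY set `J` of junctions with the strong hadj) on
g7's `gTypedQ`: the five conditions transport to the graph split at the matched set on the
`S`-fine configurations of the adjacency split — the clusters of `l` read on `inl` are the
clusters of `l` (`setOf_inl_mem_cluster_l_splitS'`), those of `h` read on `inl` are the clusters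
of `h` without `S` (`setOf_inl_mem_cluster_h_splitS'`, from g11's `cluster_eq_of_afine`), so
`𝓓″`, `𝓤′`, `X` must be blind to `J` (`mem_gTypedQ_splitS_of_mem'`, `mem_gTypedQ_of_mem_splitS'`);
the side of the split graph is insensitive to the internal edges (`mem_gTypedQ_splitS_congr`).
On a block (SwOutAdjBlockCore) the side is a lower set (`blockReal_mem_gTypedQ_of_le`) and the
rigid counting inequality holds (`card_block_le_g`, Harris on the product cube).
-/

namespace Summit.Ventures.PercRepro2

namespace LocRows

open Hull

variable {V : Type*} {E : Type*} [Fintype E] [DecidableEq E]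

open scoped Classical

section PullA

variable {ends : E → Sym2 V} {S : Set V} {l h : V} {𝓤 𝓓 𝓓'' : Set (Set V)} {X : Set V}
  {𝓤' : Set (Set V)}

omit [Fintype E] [DecidableEq E] in
/-- On an `S`-fine configuration whose split side has `inl h ∉ C(inl l)`, the cluster of `l` in
the split graph, read on `inl`, is the cluster of `l` (`l ∉ S`). -/
lemma setOf_inl_mem_cluster_l_splitS' (hlS : l ∉ S) {η : Config E} (hf : AFine ends S h η)
    (hhl : Sum.inl h ∉ cluster (splitEndsS ends S) η (Sum.inl l)) :
    {x | Sum.inl x ∈ cluster (splitEndsS ends S) η (Sum.inl l)} = cluster ends η l := by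
  ext x
  exact ⟨fun hx => conn_of_conn_splitS_inl' hx,
    fun hx => cluster_l_subset_splitS_of_afine hlS hf hhl hx⟩

omit [Fintype E] [DecidableEq E] in
/-- On an `S`-fine configuration the red cluster of `h` in the split graph, read on `inl`, is
the red cluster of `h` without `S` (`h ∉ S`). -/
lemma setOf_inl_mem_cluster_h_splitS' (hhS : h ∉ S) {η : Config E} (hf : AFine ends S h η) :
    {x | Sum.inl x ∈ cluster (splitEndsS ends S) η (Sum.inl h)} = cluster ends η h \ S := by
  ext x
  simp only [Set.mem_setOf_eq, Set.mem_sdiff]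
  by_cases hxS : x ∈ S
  · exact ⟨fun hx => absurd hx (inl_S_notMem_cluster_splitS' hxS fun h' => hhS (h' ▸ hxS)),
      fun hx => absurd hxS hx.2⟩
  · rw [inl_mem_cluster_splitS_iff_of_afine hhS hf hxS]
    exact ⟨fun hx => ⟨hx, hxS⟩, fun hx => hx.1⟩

/-- **The general doubly typed side passes to the split** on `S`-fine configurations of the
adjacency split (`l, h ∉ S`, the conditions on `h`'s clusters blind to `S`). -/
theorem mem_gTypedQ_splitS_of_mem' (hlS : l ∉ S) (hhS : h ∉ S)
    (h𝓓'' : IsLowerSet 𝓓'') (hU' : ∀ T ∈ 𝓤', T \ S ∈ 𝓤') {η : Config E}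
    (hf : AFine ends S h η) (hQ : η ∈ gTypedQ ends l h 𝓤 𝓓 𝓓'' X 𝓤') :
    η ∈ gTypedQ (splitEndsS ends S) (Sum.inl l) (Sum.inl h) (pullInl E 𝓤) (pullInl E 𝓓)
      (pullInl E 𝓓'') (Sum.inl '' X) (pullInl E 𝓤') := by
  rw [mem_gTypedQ] at hQ ⊢
  obtain ⟨hhl, hA, hB, hRh, hX, hBh⟩ := hQ
  have hhA' : Sum.inl h ∉ cluster (splitEndsS ends S) η (Sum.inl l) :=
    fun h' => hhl (Or.inl (conn_of_conn_splitS_inl' h'))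
  have hhB' : Sum.inl h ∉ cluster (splitEndsS ends S) (blue η) (Sum.inl l) :=
    fun h' => hhl (Or.inr (conn_of_conn_splitS_inl' h'))
  have eRh := setOf_inl_mem_cluster_h_splitS' hhS hf
  have eBh := setOf_inl_mem_cluster_h_splitS' hhS (afine_blue_iff.2 hf)
  refine ⟨?_, ?_, ?_, ?_, ?_, ?_⟩
  · rintro (h1 | h1)
    · exact hhA' h1
    · exact hhB' h1
  · show {x | Sum.inl x ∈ cluster (splitEndsS ends S) η (Sum.inl l)} ∈ 𝓤
    rw [setOf_inl_mem_cluster_l_splitS' hlS hf hhA']; exact hA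
  · show {x | Sum.inl x ∈ cluster (splitEndsS ends S) (blue η) (Sum.inl l)} ∈ 𝓓
    rw [setOf_inl_mem_cluster_l_splitS' hlS (afine_blue_iff.2 hf) hhB']; exact hB
  · show {x | Sum.inl x ∈ cluster (splitEndsS ends S) η (Sum.inl h)} ∈ 𝓓''
    rw [eRh]; exact h𝓓'' Set.sdiff_subset hRh
  · rintro x' ⟨x, hxX, rfl⟩ (h1 | h1)
    · have : x ∈ cluster ends η h \ S := by rw [← eRh]; exact h1
      exact hX x hxX (Or.inl this.1)
    · have : x ∈ cluster ends (blue η) h \ S := by rw [← eBh]; exact h1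
      exact hX x hxX (Or.inr this.1)
  · show {x | Sum.inl x ∈ cluster (splitEndsS ends S) (blue η) (Sum.inl h)} ∈ 𝓤'
    rw [eBh]; exact hU' _ hBh

/-- **The general doubly typed side comes back from the split** on `S`-fine configurations of
the adjacency split. -/
theorem mem_gTypedQ_of_mem_splitS' (hlS : l ∉ S) (hhS : h ∉ S)
    (h𝓓'' : IsLowerSet 𝓓'') (h𝓤' : IsUpperSet 𝓤') (hD'' : ∀ T ∈ 𝓓'', T ∪ S ∈ 𝓓'')
    (hSX : ∀ u ∈ S, u ∉ X) {η : Config E} (hf : AFine ends S h η)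
    (hQ : η ∈ gTypedQ (splitEndsS ends S) (Sum.inl l) (Sum.inl h) (pullInl E 𝓤) (pullInl E 𝓓)
      (pullInl E 𝓓'') (Sum.inl '' X) (pullInl E 𝓤')) :
    η ∈ gTypedQ ends l h 𝓤 𝓓 𝓓'' X 𝓤' := by
  rw [mem_gTypedQ] at hQ ⊢
  obtain ⟨hhl, hA, hB, hRh, hX, hBh⟩ := hQ
  have hhA' : Sum.inl h ∉ cluster (splitEndsS ends S) η (Sum.inl l) := fun h' => hhl (Or.inl h')
  have hhB' : Sum.inl h ∉ cluster (splitEndsS ends S) (blue η) (Sum.inl l) :=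
    fun h' => hhl (Or.inr h')
  have eA := setOf_inl_mem_cluster_l_splitS' hlS hf hhA'
  have eB := setOf_inl_mem_cluster_l_splitS' hlS (afine_blue_iff.2 hf) hhB'
  have eRh := setOf_inl_mem_cluster_h_splitS' hhS hf
  have eBh := setOf_inl_mem_cluster_h_splitS' hhS (afine_blue_iff.2 hf)
  refine ⟨?_, ?_, ?_, ?_, ?_, ?_⟩
  · rintro (h1 | h1)
    · rw [← eA] at h1; exact hhA' h1
    · rw [← eB] at h1; exact hhB' h1
  · rw [← eA]; exact hA
  · rw [← eB]; exact hB
  · have h1 : cluster ends η h \ S ∈ 𝓓'' := by rw [← eRh]; exact hRh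
    have h2 := hD'' _ h1
    have hsub : cluster ends η h ⊆ (cluster ends η h \ S) ∪ S := by
      intro x hx
      by_cases hxS : x ∈ S
      · exact Or.inr hxS
      · exact Or.inl ⟨hx, hxS⟩
    exact h𝓓'' hsub h2
  · intro x hxX
    have hxS : x ∉ S := fun h' => hSX x h' hxX
    rintro (h1 | h1)
    · have : Sum.inl x ∈ cluster (splitEndsS ends S) η (Sum.inl h) := by
        show x ∈ {x | Sum.inl x ∈ cluster (splitEndsS ends S) η (Sum.inl h)}
        rw [eRh]; exact ⟨h1, hxS⟩
      exact hX (Sum.inl x) ⟨x, hxX, rfl⟩ (Or.inl this)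
    · have : Sum.inl x ∈ cluster (splitEndsS ends S) (blue η) (Sum.inl h) := by
        show x ∈ {x | Sum.inl x ∈ cluster (splitEndsS ends S) (blue η) (Sum.inl h)}
        rw [eBh]; exact ⟨h1, hxS⟩
      exact hX (Sum.inl x) ⟨x, hxX, rfl⟩ (Or.inr this)
  · have h1 : cluster ends (blue η) h \ S ∈ 𝓤' := by rw [← eBh]; exact hBh
    exact h𝓤' Set.sdiff_subset h1

/-- The general doubly typed side of the split graph is insensitive to the internal edges. -/
theorem mem_gTypedQ_splitS_congr {η η' : Config E}
    (hagree : ∀ e, ¬ Internal ends S e → η e = η' e)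
    (hη : η ∈ gTypedQ (splitEndsS ends S) (Sum.inl l) (Sum.inl h) (pullInl E 𝓤) (pullInl E 𝓓)
      (pullInl E 𝓓'') (Sum.inl '' X) (pullInl E 𝓤')) :
    η' ∈ gTypedQ (splitEndsS ends S) (Sum.inl l) (Sum.inl h) (pullInl E 𝓤) (pullInl E 𝓓)
      (pullInl E 𝓓'') (Sum.inl '' X) (pullInl E 𝓤') := by
  rw [mem_gTypedQ] at hη ⊢
  rw [← hull_splitS_congr hagree (Sum.inl l), ← cluster_splitS_congr hagree (Sum.inl l),
    ← cluster_blue_splitS_congr hagree (Sum.inl l), ← cluster_splitS_congr hagree (Sum.inl h),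
    ← hull_splitS_congr hagree (Sum.inl h), ← cluster_blue_splitS_congr hagree (Sum.inl h)]
  exact hη

end PullA

section BlockG

variable {ends : E → Sym2 V} {U : Set V} {ξ : Config E} {l h : V} {J : Set V}
  {𝓤 𝓓 𝓓'' : Set (Set V)} {X : Set V} {𝓤' : Set (Set V)}

variable (hl : l ∉ U) (hloop_h : ∀ e, ends e ≠ s(h, h)) (hJU : J ⊆ U) (hhJ : h ∉ J)
  (hadj : ∀ u ∈ J, ∀ e (he : u ∈ ends e), Sym2.Mem.other he ≠ h →
    ∃ e', ends e' = s(Sym2.Mem.other he, h))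
  (h𝓤 : IsUpperSet 𝓤) (h𝓓 : IsLowerSet 𝓓) (h𝓓'' : IsLowerSet 𝓓'') (h𝓤' : IsUpperSet 𝓤')
  (hD'' : ∀ T ∈ 𝓓'', T ∪ J ∈ 𝓓'') (hU' : ∀ T ∈ 𝓤', T \ J ∈ 𝓤') (hJX : ∀ u ∈ J, u ∉ X)

variable {ζ₁ : Config E} (hcl₁ : ζ₁ ∈ outClass ends U h ξ)
  (hcore₁ : ∀ x, x ∈ cluster ends ζ₁ h → x ∈ cluster ends (blue ζ₁) h → x = h ∨ x ∈ J)

include hl hJU hhJ hadj h𝓤 h𝓓 h𝓓'' h𝓤' hD'' hU' hJX hcl₁ hcore₁ in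
/-- **The general doubly typed side is a lower set on the block.** -/
theorem blockReal_mem_gTypedQ_of_le {ω ω' : Config (BlockIdx ends (aSet ends J h ζ₁) h ζ₁)}
    (hω : ω ≤ ω')
    (hQ : blockReal ends (aSet ends J h ζ₁) h ζ₁ ω' ∈ gTypedQ ends l h 𝓤 𝓓 𝓓'' X 𝓤') :
    blockReal ends (aSet ends J h ζ₁) h ζ₁ ω ∈ gTypedQ ends l h 𝓤 𝓓 𝓓'' X 𝓤' := by
  have hlM : l ∉ aSet ends J h ζ₁ := fun h' => hl (hJU (aSet_subset h'))
  have hhM : h ∉ aSet ends J h ζ₁ := fun h' => hhJ (aSet_subset h')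
  have hD''M : ∀ T ∈ 𝓓'', T ∪ aSet ends J h ζ₁ ∈ 𝓓'' := fun T hT =>
    h𝓓'' (Set.union_subset_union_right T aSet_subset) (hD'' T hT)
  have hU'M : ∀ T ∈ 𝓤', T \ aSet ends J h ζ₁ ∈ 𝓤' := fun T hT =>
    h𝓤' (Set.sdiff_subset_sdiff_right aSet_subset) (hU' T hT)
  have hMX : ∀ u ∈ aSet ends J h ζ₁, u ∉ X := fun u hu => hJX u (aSet_subset hu)
  have h1 := mem_gTypedQ_splitS_of_mem' hlM hhM h𝓓'' hU'M
    (afine_blockReal_core hhJ hadj hcore₁ ω') hQ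
  have h2 := mem_gTypedQ_splitS_congr (blockReal_agree ω') h1
  have h3 := orbitReal_mem_gTypedQ_of_le (coreFree_blockBase_core hhJ hcore₁)
    (isUpperSet_pullInl h𝓤) (isLowerSet_pullInl h𝓓) (isLowerSet_pullInl h𝓓'')
    (isUpperSet_pullInl h𝓤') (blockBase_mem_outClass_core hJU hhJ hcl₁ hcore₁)
    (inl_notMem_splitRegionS (V := V) (E := E) hl) (fun P => hω (Sum.inl P)) h2
  have h4 := mem_gTypedQ_splitS_congr (fun e hi => (blockReal_agree ω e hi).symm) h3
  exact mem_gTypedQ_of_mem_splitS' hlM hhM h𝓓'' h𝓤' hD''M hMX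
    (afine_blockReal_core hhJ hadj hcore₁ ω) h4

include hl hloop_h hJU hhJ hadj h𝓤 h𝓓 h𝓓'' h𝓤' hD'' hU' hJX hcl₁ hcore₁ in
/-- **The rigid counting inequality on a block, general doubly typed side.** -/
theorem card_block_le_g {𝓔 : Set (Set E)} (h𝓔 : IsUpperSet 𝓔) :
    ((Finset.univ.image (blockReal ends (aSet ends J h ζ₁) h ζ₁)).filter fun ζ =>
        ζ ∈ gTypedQ ends l h 𝓤 𝓓 𝓓'' X 𝓤' ∧ redEdges ends ζ h ∈ 𝓔).card ≤
      ((Finset.univ.image (blockReal ends (aSet ends J h ζ₁) h ζ₁)).filter fun ζ =>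
        ζ ∈ gTypedQ ends l h 𝓤 𝓓 𝓓'' X 𝓤' ∧ blueEdges ends ζ h ∈ 𝓔).card := by
  have key := card_le_of_cube_edges (ends := ends) (blockReal ends (aSet ends J h ζ₁) h ζ₁)
    (blockReal_injective ζ₁) (Finset.univ.image (blockReal ends (aSet ends J h ζ₁) h ζ₁))
    (fun ζ => by simp only [Finset.mem_image, Finset.mem_univ, true_and])
    (↑(gTypedQ ends l h 𝓤 𝓓 𝓓'' X 𝓤'))
    (fun ω' ω hω hQ => blockReal_mem_gTypedQ_of_le hl hJU hhJ hadj h𝓤 h𝓓 h𝓓'' h𝓤' hD'' hU' hJX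
      hcl₁ hcore₁ hω hQ) h
    (fun 𝓔' h𝓔' ω ω' hω hω𝓔 => h𝓔' (redEdges_blockReal_mono_core hhJ hadj hcore₁ hω) hω𝓔)
    (fun 𝓔' h𝓔' ω' ω hω hω𝓔 =>
      h𝓔' (blueEdges_blockReal_anti_core hloop_h hhJ hadj hcore₁ hω) hω𝓔)
    (fun ω => blueEdges_blockReal_flipAll_core hloop_h hhJ hadj hcore₁ ω) h𝓔
  simpa only [Finset.mem_coe] using key

end BlockG

end LocRows

end Summit.Ventures.PercRepro2
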